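import Literature.MathematicalPhysics.QuantumFieldTheory.Balaban1983to89.B3Op116KernelRegularTorus

/-!
# Bałaban, *(Higgs)₂,₃ quantum fields in a finite volume III. Renormalization* [B3] — the operator (1.16) p. 414: THE ROWS OF
`G_k(T_ε,X)V_k(A,B)` IN LEIBNIZ FORM (the `D^{ε*}M` part of the expansion (I.3.16) of `V_k(A,B) = Δ_{A+B} − Δ_B`-terms read as
`(div A)·w + F_{1,k}(A)·D^ε_Bw` AT SITES) — FILE 4α of the cell's programme for the analytic half of (1.16): the algebraic identity that
removes the twice-differentiated kernel `D^ε_BG_k D^{ε*}_B` from every derivative row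

statement-level skeleton of published theorems with citation tags; proofs where landed; nothing here is a claim about the Yang–Mills mass gap

T. Bałaban, Commun. Math. Phys. **88** (1983) 411–445 [cite: Balaban1983Higgs3]; part I, Commun. Math. Phys. **85** (1982) 603–636
[cite: Balaban1982Higgs1].  PDFs held: `paper:balaban1983-higgs-2-3-quantum-fields-finite-volume` (journal page = PDF page + 410;
p. 414 = `p0004.txt`), `paper:balaban1982-cmp85-higgs23-i` (journal page = PDF page + 602; pp. 614–615 = `p0012.txt`–`p0013.txt`).

CITATION HEADER (lean-in-tree rule).  Cell `lit-balaban` (HOME `run/shared/lean/pub/lit-balaban/`), proof seat **p35** gen 22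
(unit `lit-balaban-p35`); TAKING line HOME/STATUS 2026-08-23T05:03:06Z; design `lit-balaban-p35/DESIGN-FILE4.md` §9 (why this file
exists: the outer ✗ slot of the derivative clause of (1.16), §6 there), master design `lit-balaban-r14/DESIGN-B3-116-analytic.md` §4.
SKELETON row **B3.Eq1.16 (analytic half)** (fold owner r15); decl of record `B3Sect2StatementsPart2.ScaledKernels.Ineq25At` (r15),
clause (ii).  Programme files: FILE P `B3Op116Pieces` (p40 ✓), FILE E `B3Op116ScaleChains` (r14 ✓), FILE 3(a) `B3Op116SourceForm`
(r14 ✓: THEOREM A `opV_apply_eq_srcV` and the row toolkit), FILE 3(b) `B3Op116KernelRegularTorus` (r14 ✓ v1.2, v1.3 in flight: the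
value clause at `n = n′ = 1`), THIS FILE = FILE 4α (p35), FILE 4β `B3Op116DKernelRegularTorus` (p35, next: the derivative and value
clauses for all `(n,n′)` by induction), FILE 5 `B3Ineq25Op116Smooth` (p40 ✓ 5(a)).
USED BY NAME, never restated: p40's `B3Op116Pieces.{fOne, mulM, mulM_apply, mulM_apply_tgt, U_neg_apply_U_apply, norm_U_apply,
norm_fOne_apply_le, U_apply_eq_add_smul_fOne}`, the typer's `HiggsLattice.ChargeData.{U_add, star_U}`, `HiggsCovariancePos.{sum_site_dir,
shift_unshift}`, r14's `B3Op116SourceForm.{srcV, srcMD, srcDM, srcMM, avgSrc, map_srcV, norm_mapE_single_le, norm_mapE_srcMD_le,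
norm_mapE_srcMM_le, covDerivAt}`, `B3Op116KernelRegularTorus.{inv_smul_sum_dip_eq_adjCovDeriv, col, dcol}` (the charge field
`b ↦ M_bw(b₊)` is r14's `gM` of v1.3, inlined here).

## What is printed

[B3] p. 414 [PDF 4] (verbatim): *"for n, n′ sufficiently large, a kernel of the operator (1.16) is a sufficiently regular function of
both variables. More exactly the Hölder norms of the covariant derivatives of this kernel, the norms defined for example in the
inequalities (I.2.24) and (I.2.25) of Proposition I.2.1, are exponentially decaying with the distance of the arguments and are uniformly
bounded by O(1)(e(L^kε)^{1−α})^{n+n′}, where α > 0 but can be arbitrarily small. This estimate follows easily from the properties of the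
propagators G_k(Ω, A) proved in the next paper."*  [B1] p. 614–615 [PDF 12–13]: (3.14) `U(A) = 1 + ηF_{1,k}(A)`, and *"The above two
formulas imply an expansion of the covariant Laplace operator with the Neumann boundary conditions on arbitrary Ω"* (3.16) — the
operator `V_k(A,B)` of (1.16) is (minus) the first-order part of (3.16): `Σ_b[D^{ε*}_BM_b + M_b^*D^ε_B + M_b^*M_b]` plus the averaging
terms (r14's THEOREM A `B3Op116SourceForm.opV_apply_eq_srcV`, `M_b = U(εB_b)F_{1,k}(A_b)`).

## What this file proves, and how

§1 **THEOREM A′ — the `D^{ε*}M` sources in Leibniz form** (torus, exact): with `F₁(a) = ε⁻¹(U(εa) − 1)` and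
`N_b := ε⁻¹(F₁(A_{b−e_μ}) − F₁(A_b))` (`nMul`; `b − e_μ` the preceding collinear bond),
`ε⁻¹Σ_b srcDM_b w = Σ_b δ_{b₋}·[N_b w(b₋) − F₁(A_b)(D^ε_Bw)(b)]` (`inv_smul_sum_srcDM_eq`) — the lattice form of
`D_B^*(M·w) = (div A)·w + F₁(A)·D_Bw`: r14's divergence identity `inv_smul_sum_dip_eq_adjCovDeriv`, `U(−εB_b)M_b = F₁(A_b)`, p40's
`M_bw(b₊) = F₁(A_b)w(b₋) + εF₁(A_b)(D^ε_Bw)(b)` (`mulM_apply_tgt`), and the commutativity of the transports.  Sizes: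
`F₁(a)v − F₁(a′)v = U(εa′)F₁(a − a′)v` (`fOne_sub_fOne_apply`), hence `‖N_bv‖ ≤ ε⁻¹|e|·|A_{b−e_μ} − A_b|·‖v‖ ≤ ε⁻¹|e|δ_A‖v‖` under the
(I.2.23)-shape regularity `|A_{⟨z+e_ν,μ⟩} − A_{⟨z,μ⟩}| ≤ δ_A` of `A` (`norm_nMul_apply_le`), and `‖F₁(A_b)X‖ ≤ |e|s‖X‖` for `|A_b| ≤ s`.
**THEOREM A″** (`sum_srcMD_eq`, mirror): `Σ_b srcMD_b w = −ε⁻¹Σ_b dip_b(F₁(−A_b)w(b₋)) + Σ_b δ_{b₋}·N̄_bw(b₋)` (`N̄ = nMul` of `−A`;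
`M_b^* = U(−εB_b)F₁(−A_b)`, `mulMT_apply`) — the `M^*D` sources read only VALUES of `w` (for dipole sources, p40's FILE 4M).
§2 **The L-form row through any linear functional `T`** (`map_srcV_univ_leibniz`, `norm_mapE_srcV_le_leibniz`):
`‖T(V_kw)‖ ≤ Σ_b[|e|s‖(D^ε_Bw)(b)‖·(κ_T(b₊) + κ_T(b₋)) + ε⁻¹|e|δ_A‖w(b₋)‖·κ_T(b₋) + (|e|s)²‖w(b₊)‖·κ_T(b₊)] + |a_k|(L^kε)^{−2}‖T(avgSrc w)‖`,
`κ_T(y) = Σ_i‖Te_{(y,i)}‖` — every source is a SITE source: no `ε^{−1}·‖T(dip_be_i)‖`, no field `D^ε_BG_kD^{ε*}_Bg` (compare r14's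
`B3Op116SourceForm.norm_mapE_srcV_le` and `B3Op116KernelRegularTorus.norm_covDeriv_G_srcV_le`).
§3 **The rows of `G_k(T_ε,X)V_k(A,B)` in r14's `κ` vocabulary**: THE DERIVATIVE ROW
`‖(D^ε_BG_k(T,X)V_kw)(b₀)‖ ≤ Σ_b[|e|s‖D_Bw(b)‖(κ^D_{B,X}(b₀,b₊) + κ^D_{B,X}(b₀,b₋)) + ε⁻¹|e|δ_A‖w(b₋)‖κ^D_{B,X}(b₀,b₋) + (|e|s)²‖w(b₊)‖κ^D_{B,X}(b₀,b₊)]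
+ |a_k|(L^kε)^{−2}‖(D^ε_BG_k(T,X)avgSrc w)(b₀)‖` (`norm_covDeriv_G_srcV_le_leibniz`; `κ^D = dcol`, exponent 1 in the (2.10) dictionary) and the
value row with `κ = col` only (`norm_G_srcV_apply_le_leibniz`).  CONSEQUENCE (DESIGN-FILE4 §9): in the derivative clause of (1.16) every
factor of every chain is a column (exponent 2) or a differentiated column (exponent 1) of a propagator at a regular field — pure
multi-scale bookkeeping, uniformly bounded iff the exponents sum to `> d`, i.e. `n + n′ + 1 > d` (print's *"n, n′ sufficiently large"*);
the price is the regularity `δ_A` of `A` (print's `Ã = a_kG_kQ_k^*A′` is a smooth background; `δ_A ≤ δ_B + δ_{A+B}` when `B` and `A + B`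
are both (I.2.23)-regular, `reg_of_reg_add`).

## Honest scope

Exact identities and triangle-inequality bounds only (no decay, no scale sums, no smallness).  THEOREM A′ is a TORUS identity
(`Ω = T_ε`: every site has its `2d` bonds; on a region with Neumann bonds the rearrangement leaves an `ε^{−1}`-size boundary term at
sites with a missing collinear neighbour — not treated).  Arbitrary `A, B, X, m², a, k`, any `N, d, L`; `δ_A`, `s` are free parameters
of the hypotheses `hregA`, `hA`.  THEOREM A″ (`sum_srcMD_eq`, the mirror identity for the
`M^*D^ε_B` sources, derivative on the test side) is stated as a field identity for p40's FILE 4M (the mixed clause of (1.16), which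
needs one Calderón–Zygmund cancellation, DESIGN-FILE4 §9(d), is NOT here).  Two concrete `def`s (`pred`, `nMul`); no `def … : Prop`,
no new named fact; axioms standard.  Value = the algebraic skeleton of a located by-reference step of B3, NOT summit progress.
-/

noncomputable section

open scoped BigOperators InnerProductSpace

namespace Literature.MathematicalPhysics.QuantumFieldTheory.Balaban1983to89.B3Op116LeibnizRows

open HiggsLattice (ChargeData ScalarField covDeriv)
open HiggsCovariance (propagatorK E)
open HiggsCovariancePos (Inside shift_unshift sum_site_dir)
open B1Eq230FluctCov (Ix cb)
open B3Ineq210MixedRegularTorus (dip)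
open B3Op116Pieces (fOne mulM mulM_apply mulM_apply_tgt U_neg_apply_U_apply norm_U_apply norm_fOne_apply_le
  U_apply_eq_add_smul_fOne)
open B3Op116SourceForm (srcV srcMD srcDM srcMM avgSrc map_srcV norm_mapE_single_le norm_mapE_srcMD_le norm_mapE_srcMM_le
  covDerivAt)
open B3Op116KernelRegularTorus (inv_smul_sum_dip_eq_adjCovDeriv col dcol)

variable {P : HiggsLattice.Params} {N : ℕ}

/-! ## §1 THEOREM A′: the `D^{ε*}M` sources of `V_k(A,B)` in Leibniz form -/

section Leibniz

variable (C : ChargeData N) (A B : HiggsLattice.VecField P 0)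

/-- The preceding collinear bond `b − e_μ = ⟨b₋ − εe_μ, b₋⟩` of `b = ⟨b₋, b₋ + εe_μ⟩`. [cite: Balaban1982Higgs1, (1.4) p.604] -/
def pred (b : HiggsLattice.PBond P 0) : HiggsLattice.PBond P 0 := ⟨b.src.unshift b.dir, b.dir⟩

/-- `(b − e_μ)₊ = b₋`. [cite: Balaban1982Higgs1, (1.4) p.604] -/
@[simp] theorem pred_tgt (b : HiggsLattice.PBond P 0) : (pred b).tgt = b.src := shift_unshift b.src b.dir

/-- **The difference multiplier `N_b = ε⁻¹(F_{1,k}(A_{b−e_μ}) − F_{1,k}(A_b))`** — the lattice divergence of the multiplier `F₁(A)`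
along the direction of `b` (`|e|·(div A)` to first order). [cite: Balaban1982Higgs1, (3.14) p.614, (3.16) p.615] -/
def nMul (b : HiggsLattice.PBond P 0) : E N →L[ℝ] E N :=
  (P.mesh 0)⁻¹ • (fOne C (P.mesh 0) (A (pred b)) - fOne C (P.mesh 0) (A b))

/-- `N_bv = ε⁻¹(F₁(A_{b−e_μ})v − F₁(A_b)v)`. [cite: Balaban1982Higgs1, (3.14) p.614] -/
theorem nMul_apply (b : HiggsLattice.PBond P 0) (v : E N) :
    nMul C A b v = (P.mesh 0)⁻¹ • (fOne C (P.mesh 0) (A (pred b)) v - fOne C (P.mesh 0) (A b) v) := rfl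

/-- **`F₁(a)v − F₁(a′)v = U(εa′)F₁(a − a′)v`** (the group law `U(a) = U(a′)U(a − a′)`). [cite: Balaban1982Higgs1, (1.7) p.605, (3.14) p.614] -/
theorem fOne_sub_fOne_apply (η a a' : ℝ) (v : E N) :
    fOne C η a v - fOne C η a' v = C.U η a' (fOne C η (a - a') v) := by
  have hU : C.U η a' (C.U η (a - a') v) = C.U η a v := by
    rw [← mul_apply_eq_comp, ← ChargeData.U_add, add_sub_cancel]
  simp only [B3Op116Pieces.fOne_apply, map_smul, map_sub, hU, ← smul_sub, sub_sub_sub_cancel_right]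

/-- `‖F₁(a)v − F₁(a′)v‖ ≤ |e|·|a − a′|·‖v‖`. [cite: Balaban1982Higgs1, (3.14) p.614] -/
theorem norm_fOne_sub_fOne_apply_le (a a' : ℝ) (v : E N) :
    ‖fOne C (P.mesh 0) a v - fOne C (P.mesh 0) a' v‖ ≤ |C.e| * |a - a'| * ‖v‖ := by
  rw [fOne_sub_fOne_apply C (P.mesh 0), norm_U_apply C]
  exact norm_fOne_apply_le C (P.mesh_pos 0).ne' _ v

/-- **`‖N_bv‖ ≤ ε⁻¹|e|·|A_{b−e_μ} − A_b|·‖v‖`**. [cite: Balaban1982Higgs1, (3.14) p.614, (3.16) p.615] -/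
theorem norm_nMul_apply_le' (b : HiggsLattice.PBond P 0) (v : E N) :
    ‖nMul C A b v‖ ≤ (P.mesh 0)⁻¹ * (|C.e| * |A (pred b) - A b| * ‖v‖) := by
  rw [nMul_apply, norm_smul, Real.norm_eq_abs, abs_of_pos (inv_pos.mpr (P.mesh_pos 0))]
  exact mul_le_mul_of_nonneg_left (norm_fOne_sub_fOne_apply_le C _ _ v) (inv_nonneg.mpr (P.mesh_pos 0).le)

/-- **`‖N_bv‖ ≤ ε⁻¹|e|δ_A‖v‖`** under the (I.2.23)-shape regularity `|A_{⟨z+εe_ν,μ⟩} − A_{⟨z,μ⟩}| ≤ δ_A` of `A` (used with `ν = μ`).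
[cite: Balaban1982Higgs1, (2.23) p.610, (3.14) p.614] -/
theorem norm_nMul_apply_le {δA : ℝ}
    (hregA : ∀ (z : HiggsLattice.Site P 0) (μ ν : Fin P.d), |A ⟨z.shift ν, μ⟩ - A ⟨z, μ⟩| ≤ δA)
    (b : HiggsLattice.PBond P 0) (v : E N) :
    ‖nMul C A b v‖ ≤ (P.mesh 0)⁻¹ * (|C.e| * δA) * ‖v‖ := by
  have h2 : |A (pred b) - A b| ≤ δA := by
    rw [abs_sub_comm]
    have h := hregA (b.src.unshift b.dir) b.dir b.dir
    simp only [shift_unshift] at h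
    exact h
  refine (norm_nMul_apply_le' C A b v).trans ?_
  rw [show (P.mesh 0)⁻¹ * (|C.e| * δA) * ‖v‖ = (P.mesh 0)⁻¹ * (|C.e| * δA * ‖v‖) by ring]
  exact mul_le_mul_of_nonneg_left (mul_le_mul_of_nonneg_right (mul_le_mul_of_nonneg_left h2 (abs_nonneg _))
    (norm_nonneg _)) (inv_nonneg.mpr (P.mesh_pos 0).le)

/-- The regularity of `A` from that of `B` and `A + B`: `δ_A ≤ δ_{A+B} + δ_B` (triangle inequality). [cite: Balaban1982Higgs1, (2.23) p.610] -/
theorem reg_of_reg_add {δB δAB : ℝ}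
    (hregB : ∀ (z : HiggsLattice.Site P 0) (μ ν : Fin P.d), |B ⟨z.shift ν, μ⟩ - B ⟨z, μ⟩| ≤ δB)
    (hregAB : ∀ (z : HiggsLattice.Site P 0) (μ ν : Fin P.d), |(A + B) ⟨z.shift ν, μ⟩ - (A + B) ⟨z, μ⟩| ≤ δAB)
    (z : HiggsLattice.Site P 0) (μ ν : Fin P.d) : |A ⟨z.shift ν, μ⟩ - A ⟨z, μ⟩| ≤ δAB + δB := by
  have h1 := hregB z μ ν
  have h2 := hregAB z μ ν
  simp only [Pi.add_apply] at h2
  have e : A ⟨z.shift ν, μ⟩ - A ⟨z, μ⟩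
      = ((A ⟨z.shift ν, μ⟩ + B ⟨z.shift ν, μ⟩) - (A ⟨z, μ⟩ + B ⟨z, μ⟩)) - (B ⟨z.shift ν, μ⟩ - B ⟨z, μ⟩) := by ring
  rw [e]
  exact (abs_sub _ _).trans (add_le_add h2 h1)

/-- `U(−εB_b)(M_bv) = F₁(A_b)v` (`M_b = U(εB_b)F₁(A_b)`). [cite: Balaban1982Higgs1, (3.14) p.614] -/
theorem U_neg_mulM_apply (b : HiggsLattice.PBond P 0) (v : E N) :
    C.U (P.mesh 0) (-(B b)) (mulM C A B b v) = fOne C (P.mesh 0) (A b) v := by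
  rw [mulM_apply, U_neg_apply_U_apply]

/-- **`M_bw(b₊) = F₁(A_b)w(b₋) + ε·F₁(A_b)(D^ε_Bw)(b)`** (p40's `mulM_apply_tgt` with `U(εa)X − X = εF₁(a)X`; all transports commute).
[cite: Balaban1982Higgs1, (3.14) p.614] -/
theorem mulM_apply_tgt_eq (w : ScalarField P 0 N) (b : HiggsLattice.PBond P 0) :
    mulM C A B b (w b.tgt)
      = fOne C (P.mesh 0) (A b) (w b.src) + P.mesh 0 • fOne C (P.mesh 0) (A b) (covDeriv C B w b) := by
  rw [mulM_apply_tgt, U_apply_eq_add_smul_fOne C (P.mesh_pos 0).ne' (A b) (covDeriv C B w b)]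
  abel

/-- **THEOREM A′ — the `D^{ε*}M` sources of `V_k(A,B)` in Leibniz form** (torus):
`ε⁻¹Σ_b srcDM_b w = Σ_b δ_{b₋}·[N_b w(b₋) − F₁(A_b)(D^ε_Bw)(b)]` — the divergence `D^{ε*}_B(b ↦ M_bw(b₊))` of r14's `inv_smul_sum_dip_eq_adjCovDeriv`
expanded by the product rule: the lattice form of `(div A)·w + F₁(A)·D_Bw`; no `ε^{−1}` survives except inside `N_b = O(ε⁻¹|e|δ_A)`.
[cite: Balaban1982Higgs1, (3.14)–(3.16) pp.614–615] [cite: Balaban1983Higgs3, (1.16) p.414] -/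
theorem inv_smul_sum_srcDM_eq (w : ScalarField P 0 N) :
    (P.mesh 0)⁻¹ • (∑ b : HiggsLattice.PBond P 0, srcDM C A B b w)
      = ∑ b : HiggsLattice.PBond P 0,
          (Pi.single b.src (nMul C A b (w b.src) - fOne C (P.mesh 0) (A b) (covDeriv C B w b)) : ScalarField P 0 N) := by
  have hε : P.mesh 0 ≠ 0 := (P.mesh_pos 0).ne'
  have h1 : (∑ b : HiggsLattice.PBond P 0, srcDM C A B b w)
      = ∑ b : HiggsLattice.PBond P 0, dip C B b ((fun b' : HiggsLattice.PBond P 0 => mulM C A B b' (w b'.tgt)) b) :=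
    Finset.sum_congr rfl fun b _ => rfl
  rw [h1, inv_smul_sum_dip_eq_adjCovDeriv C B (fun b' : HiggsLattice.PBond P 0 => mulM C A B b' (w b'.tgt))]
  funext x
  rw [Finset.sum_apply, ← sum_site_dir (fun (y : HiggsLattice.Site P 0) (ν : Fin P.d) =>
    (Pi.single y (nMul C A ⟨y, ν⟩ (w y) - fOne C (P.mesh 0) (A ⟨y, ν⟩) (covDeriv C B w ⟨y, ν⟩)) : ScalarField P 0 N) x),
    Finset.sum_comm]
  have hin : ∀ ν : Fin P.d, ∑ y : HiggsLattice.Site P 0,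
      (Pi.single y (nMul C A ⟨y, ν⟩ (w y) - fOne C (P.mesh 0) (A ⟨y, ν⟩) (covDeriv C B w ⟨y, ν⟩)) : ScalarField P 0 N) x
        = nMul C A ⟨x, ν⟩ (w x) - fOne C (P.mesh 0) (A ⟨x, ν⟩) (covDeriv C B w ⟨x, ν⟩) := by
    intro ν
    rw [Finset.sum_eq_single x]
    · rw [Pi.single_eq_same]
    · intro y _ hy; rw [Pi.single_eq_of_ne (Ne.symm hy)]
    · intro h; exact absurd (Finset.mem_univ x) h
  simp only [hin, Finset.smul_sum]
  refine Finset.sum_congr rfl fun ν _ => ?_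
  -- the two charges across the site x in the direction ν
  have htgt : (⟨x.unshift ν, ν⟩ : HiggsLattice.PBond P 0).tgt = x := shift_unshift x ν
  have hsrc : (⟨x, ν⟩ : HiggsLattice.PBond P 0).src = x := rfl
  have hp : mulM C A B ⟨x, ν⟩ (w (⟨x, ν⟩ : HiggsLattice.PBond P 0).tgt)
      = fOne C (P.mesh 0) (A ⟨x, ν⟩) (w x) + P.mesh 0 • fOne C (P.mesh 0) (A ⟨x, ν⟩) (covDeriv C B w ⟨x, ν⟩) := by
    rw [mulM_apply_tgt_eq, hsrc]
  have hpred : pred (⟨x, ν⟩ : HiggsLattice.PBond P 0) = ⟨x.unshift ν, ν⟩ := rfl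
  rw [htgt, ChargeData.star_U, U_neg_mulM_apply, hp, nMul_apply, hpred, ← sub_sub, smul_sub, smul_smul,
    inv_mul_cancel₀ hε, one_smul]

/-! ### THEOREM A″: the mirror identity for the `M^*D^ε_B` sources (the derivative moved to the test side) -/

/-- `⟨F₁(−a)X, Y⟩ = ⟨X, F₁(a)Y⟩` (`U(a)^* = U(−a)`). [cite: Balaban1982Higgs1, (1.7) p.605, (3.14) p.614] -/
theorem inner_fOne_neg_left (η a : ℝ) (X Y : E N) : ⟪fOne C η (-a) X, Y⟫_ℝ = ⟪X, fOne C η a Y⟫_ℝ := by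
  rw [B3Op116Pieces.fOne_apply, B3Op116Pieces.fOne_apply, inner_smul_left, inner_sub_left,
    B3Ineq210MixedRegularTorus.inner_U_neg_left, inner_smul_right, inner_sub_right]
  simp

/-- `F₁(a)` commutes with every transport `U(b)`. [cite: Balaban1982Higgs1, (1.7) p.605, (3.14) p.614] -/
theorem fOne_U_comm (η a b : ℝ) (v : E N) : fOne C η a (C.U η b v) = C.U η b (fOne C η a v) := by
  rw [B3Op116Pieces.fOne_apply, B3Op116Pieces.fOne_apply, map_smul, map_sub, ← mul_apply_eq_comp, B3Op116Pieces.U_comm,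
    mul_apply_eq_comp]

/-- **`M_b^*X = U(−εB_b)F₁(−A_b)X`** (the adjoint of `M_b = U(εB_b)F₁(A_b)`). [cite: Balaban1982Higgs1, (3.14) p.614, (3.16) p.615] -/
theorem mulMT_apply (b : HiggsLattice.PBond P 0) (X : E N) :
    B3Op116SourceForm.mulMT C A B b X = C.U (P.mesh 0) (-(B b)) (fOne C (P.mesh 0) (-(A b)) X) := by
  refine ext_inner_right ℝ fun v => ?_
  rw [B3Op116SourceForm.inner_mulMT_left, mulM_apply, B3Ineq210MixedRegularTorus.inner_U_neg_left, inner_fOne_neg_left,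
    fOne_U_comm]

/-- **The `M^*D` charge in Leibniz form**: `M_b^*(D^ε_Bw)(b) = ε⁻¹F₁(−A_b)w(b₊) − ε⁻¹U(−εB_b)F₁(−A_b)w(b₋)`.
[cite: Balaban1982Higgs1, (1.7) p.605, (3.14) p.614] -/
theorem mulMT_covDeriv (w : ScalarField P 0 N) (b : HiggsLattice.PBond P 0) :
    B3Op116SourceForm.mulMT C A B b (covDeriv C B w b)
      = (P.mesh 0)⁻¹ • fOne C (P.mesh 0) (-(A b)) (w b.tgt)
        - (P.mesh 0)⁻¹ • C.U (P.mesh 0) (-(B b)) (fOne C (P.mesh 0) (-(A b)) (w b.src)) := by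
  rw [mulMT_apply]
  unfold covDeriv
  rw [map_smul, map_sub, map_smul, map_sub, fOne_U_comm, U_neg_apply_U_apply, smul_sub]

/-- **THEOREM A″ — the `M^*D^ε_B` sources of `V_k(A,B)` with the derivative on the test side** (torus, the mirror of A′):
`Σ_b srcMD_b w = −ε⁻¹Σ_b dip_b(F₁(−A_b)w(b₋)) + Σ_b δ_{b₋}·N̄_b w(b₋)`, `N̄_b = ε⁻¹(F₁(−A_{b−e_μ}) − F₁(−A_b))` (`nMul` of `−A`) — the
`M^*D` sources read only VALUES of `w`, through a dipole (which a propagator turns into ONE derivative of its own column, r14's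
`norm_propagatorK_dip_apply_le`) and a site source of size `ε⁻¹|e|δ_A`. [cite: Balaban1982Higgs1, (3.14)–(3.16) pp.614–615] [cite: Balaban1983Higgs3, (1.16) p.414] -/
theorem sum_srcMD_eq (w : ScalarField P 0 N) :
    (∑ b : HiggsLattice.PBond P 0, srcMD C A B b w)
      = -((P.mesh 0)⁻¹ • ∑ b : HiggsLattice.PBond P 0, dip C B b (fOne C (P.mesh 0) (-(A b)) (w b.src)))
        + ∑ b : HiggsLattice.PBond P 0, (Pi.single b.src (nMul C (-A) b (w b.src)) : ScalarField P 0 N) := by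
  have hε : P.mesh 0 ≠ 0 := (P.mesh_pos 0).ne'
  rw [inv_smul_sum_dip_eq_adjCovDeriv C B (fun b : HiggsLattice.PBond P 0 => fOne C (P.mesh 0) (-(A b)) (w b.src))]
  funext x
  -- left side: the bonds with head x
  have hL : ∀ ν : Fin P.d, ∑ y : HiggsLattice.Site P 0, srcMD C A B ⟨y, ν⟩ w x
      = B3Op116SourceForm.mulMT C A B ⟨x.unshift ν, ν⟩ (covDeriv C B w ⟨x.unshift ν, ν⟩) := by
    intro ν
    rw [Finset.sum_eq_single (x.unshift ν)]
    · have htgt : (⟨x.unshift ν, ν⟩ : HiggsLattice.PBond P 0).tgt = x := shift_unshift x ν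
      rw [← B3Op116SourceForm.srcMD_apply_tgt, htgt]
    · intro y _ hy
      apply B3Op116SourceForm.srcMD_apply_of_ne
      intro hx
      apply hy
      have h2 : (⟨y, ν⟩ : HiggsLattice.PBond P 0).tgt = y.shift ν := rfl
      rw [h2] at hx
      rw [hx, HiggsCovariancePos.unshift_shift]
    · intro h; exact absurd (Finset.mem_univ _) h
  -- right side: the site sources at x
  have hR : ∀ ν : Fin P.d, ∑ y : HiggsLattice.Site P 0, (Pi.single y (nMul C (-A) ⟨y, ν⟩ (w y)) : ScalarField P 0 N) x
      = nMul C (-A) ⟨x, ν⟩ (w x) := by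
    intro ν
    rw [Finset.sum_eq_single x]
    · rw [Pi.single_eq_same]
    · intro y _ hy; rw [Pi.single_eq_of_ne (Ne.symm hy)]
    · intro h; exact absurd (Finset.mem_univ x) h
  rw [Finset.sum_apply, Pi.add_apply, Pi.neg_apply, Finset.sum_apply]
  rw [← sum_site_dir (fun (y : HiggsLattice.Site P 0) (ν : Fin P.d) => srcMD C A B ⟨y, ν⟩ w x), Finset.sum_comm]
  simp only [hL]
  rw [← sum_site_dir (fun (y : HiggsLattice.Site P 0) (ν : Fin P.d) =>
    (Pi.single y (nMul C (-A) ⟨y, ν⟩ (w y)) : ScalarField P 0 N) x), Finset.sum_comm]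
  simp only [hR, Finset.smul_sum, ← Finset.sum_neg_distrib, ← Finset.sum_add_distrib]
  refine Finset.sum_congr rfl fun ν _ => ?_
  have hsrc : (⟨x.unshift ν, ν⟩ : HiggsLattice.PBond P 0).src = x.unshift ν := rfl
  have htgt : (⟨x.unshift ν, ν⟩ : HiggsLattice.PBond P 0).tgt = x := shift_unshift x ν
  have hpred : pred (⟨x, ν⟩ : HiggsLattice.PBond P 0) = ⟨x.unshift ν, ν⟩ := rfl
  rw [mulMT_covDeriv, htgt, hsrc, nMul_apply, hpred, ChargeData.star_U]
  simp only [Pi.neg_apply]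
  rw [smul_sub, smul_sub]
  abel

/-- the charge of the dipole of A″: `‖F₁(−A_b)X‖ ≤ |e|s‖X‖` for `|A_b| ≤ s`. [cite: Balaban1982Higgs1, (3.14) p.614] -/
theorem norm_fOne_neg_apply_le {s : ℝ} {b : HiggsLattice.PBond P 0} (hA : |A b| ≤ s) (X : E N) :
    ‖fOne C (P.mesh 0) (-(A b)) X‖ ≤ |C.e| * s * ‖X‖ := by
  refine (norm_fOne_apply_le C (P.mesh_pos 0).ne' _ X).trans ?_
  rw [abs_neg]
  exact mul_le_mul_of_nonneg_right (mul_le_mul_of_nonneg_left hA (abs_nonneg _)) (norm_nonneg _)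

/-- the regularity hypothesis for `−A` from that for `A`. [cite: Balaban1982Higgs1, (2.23) p.610] -/
theorem reg_neg {δA : ℝ} (hregA : ∀ (z : HiggsLattice.Site P 0) (μ ν : Fin P.d), |A ⟨z.shift ν, μ⟩ - A ⟨z, μ⟩| ≤ δA)
    (z : HiggsLattice.Site P 0) (μ ν : Fin P.d) : |(-A) ⟨z.shift ν, μ⟩ - (-A) ⟨z, μ⟩| ≤ δA := by
  simp only [Pi.neg_apply]
  rw [show -A ⟨z.shift ν, μ⟩ - -A ⟨z, μ⟩ = -(A ⟨z.shift ν, μ⟩ - A ⟨z, μ⟩) by ring, abs_neg]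
  exact hregA z μ ν

end Leibniz

/-! ## §2 The L-form row of `V_k(A,B)w` through a linear functional: site sources only -/

section Row

variable (C : ChargeData N) (A B : HiggsLattice.VecField P 0) (a : ℝ) (k : ℕ)
variable {M' : Type*} [NormedAddCommGroup M'] [NormedSpace ℝ M']

/-- **Separation of the sources in Leibniz form** (torus): `T(V_kw) = −Σ_b[T srcMD_b w + T(δ_{b₋}(N_bw(b₋) − F₁(A_b)D_Bw(b))) + T srcMM_b w]
− a_k(L^kε)^{−2}T(avgSrc w)` (r14's `map_srcV` + THEOREM A′). [cite: Balaban1982Higgs1, (3.16) p.615] [cite: Balaban1983Higgs3, (1.16) p.414] -/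
theorem map_srcV_univ_leibniz (T : ScalarField P 0 N →ₗ[ℝ] M') (w : ScalarField P 0 N) :
    T (srcV C A B k Finset.univ a w)
      = -(∑ b : HiggsLattice.PBond P 0,
            (T (srcMD C A B b w)
              + T (Pi.single b.src (nMul C A b (w b.src) - fOne C (P.mesh 0) (A b) (covDeriv C B w b)))
              + T (srcMM C A B b w)))
        - (B1.aSeq a P.L k * ((P.mesh k)⁻¹ ^ 2)) • T (avgSrc C A B k w) := by
  rw [map_srcV]
  have hIn : ∀ b : HiggsLattice.PBond P 0, Inside (Finset.univ : Finset (HiggsLattice.Site P 0)) b :=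
    fun b => ⟨Finset.mem_univ _, Finset.mem_univ _⟩
  simp only [if_pos (hIn _)]
  congr 2
  have hDM : ∑ b : HiggsLattice.PBond P 0, (P.mesh 0)⁻¹ • T (srcDM C A B b w)
      = ∑ b : HiggsLattice.PBond P 0,
          T (Pi.single b.src (nMul C A b (w b.src) - fOne C (P.mesh 0) (A b) (covDeriv C B w b))) := by
    rw [← map_sum, ← inv_smul_sum_srcDM_eq, map_smul, map_sum, Finset.smul_sum]
  simp only [Finset.sum_add_distrib, hDM]

/-- **THE L-FORM ROW OF `V_k(A,B)w` THROUGH A VECTOR-VALUED LINEAR FUNCTIONAL `T`** (torus; `sup_b|A_b| ≤ s`, `A` regular with `δ_A`):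
`‖T(V_kw)‖ ≤ Σ_b[|e|s‖(D^ε_Bw)(b)‖κ_T(b₊) + (ε⁻¹|e|δ_A‖w(b₋)‖ + |e|s‖(D^ε_Bw)(b)‖)κ_T(b₋) + (|e|s)²‖w(b₊)‖κ_T(b₊)] + |a_k|(L^kε)^{−2}‖T(avgSrc w)‖`,
`κ_T(y) = Σ_i‖Te_{(y,i)}‖` — every source sits at a SITE (no dipole through `T`, no `ε^{−1}` outside `δ_A`).
[cite: Balaban1982Higgs1, (3.16) p.615] [cite: Balaban1983Higgs3, (1.16) p.414] -/
theorem norm_mapE_srcV_le_leibniz (T : ScalarField P 0 N →ₗ[ℝ] M') {s δA : ℝ}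
    (hA : ∀ b : HiggsLattice.PBond P 0, |A b| ≤ s)
    (hregA : ∀ (z : HiggsLattice.Site P 0) (μ ν : Fin P.d), |A ⟨z.shift ν, μ⟩ - A ⟨z, μ⟩| ≤ δA)
    (w : ScalarField P 0 N) :
    ‖T (srcV C A B k Finset.univ a w)‖
      ≤ (∑ b : HiggsLattice.PBond P 0,
          (|C.e| * s * ‖covDeriv C B w b‖ * (∑ i : Ix N, ‖T (cb P N 0 (b.tgt, i))‖)
            + ((P.mesh 0)⁻¹ * (|C.e| * δA) * ‖w b.src‖ + |C.e| * s * ‖covDeriv C B w b‖)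
                * (∑ i : Ix N, ‖T (cb P N 0 (b.src, i))‖)
            + (|C.e| * s) ^ 2 * ‖w b.tgt‖ * (∑ i : Ix N, ‖T (cb P N 0 (b.tgt, i))‖)))
        + |B1.aSeq a P.L k| * (P.mesh k)⁻¹ ^ 2 * ‖T (avgSrc C A B k w)‖ := by
  rw [map_srcV_univ_leibniz]
  refine (norm_sub_le _ _).trans (add_le_add ?_ ?_)
  · rw [norm_neg]
    refine (norm_sum_le _ _).trans (Finset.sum_le_sum fun b _ => ?_)
    refine (norm_add_le _ _).trans (add_le_add ((norm_add_le _ _).trans (add_le_add ?_ ?_)) ?_)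
    · exact norm_mapE_srcMD_le C A B T (hA b) w
    · refine (norm_mapE_single_le T b.src _).trans
        (mul_le_mul_of_nonneg_right ?_ (Finset.sum_nonneg fun _ _ => norm_nonneg _))
      refine (norm_sub_le _ _).trans (add_le_add (norm_nMul_apply_le C A hregA b _) ?_)
      exact (norm_fOne_apply_le C (P.mesh_pos 0).ne' (A b) _).trans
        (mul_le_mul_of_nonneg_right (mul_le_mul_of_nonneg_left (hA b) (abs_nonneg _)) (norm_nonneg _))
    · exact norm_mapE_srcMM_le C A B T (hA b) w
  · rw [norm_smul, Real.norm_eq_abs, abs_mul, abs_of_nonneg (pow_nonneg (inv_nonneg.mpr (P.mesh_pos k).le) 2)]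

end Row

/-! ## §3 The derivative row and the value row of `G_k(T_ε,X)V_k(A,B)` in the `κ` vocabulary -/

section GRows

variable (C : ChargeData N) (A B X : HiggsLattice.VecField P 0) (msq a : ℝ) (k : ℕ)

/-- **THE DERIVATIVE ROW OF `G_k(T,X)V_k(A,B)w` IN LEIBNIZ FORM** (torus; `sup_b|A_b| ≤ s`, `A` regular with `δ_A`):
`‖(D^ε_BG_k(T,X)V_kw)(b₀)‖ ≤ Σ_b[|e|s‖(D^ε_Bw)(b)‖κ^D_{B,X}(b₀,b₊) + (ε⁻¹|e|δ_A‖w(b₋)‖ + |e|s‖(D^ε_Bw)(b)‖)κ^D_{B,X}(b₀,b₋) +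
(|e|s)²‖w(b₊)‖κ^D_{B,X}(b₀,b₊)] + |a_k|(L^kε)^{−2}‖(D^ε_BG_k(T,X)avgSrc w)(b₀)‖` — differentiated columns `κ^D = dcol` (exponent 1 in the
(2.10) dictionary) ONLY: no field `D^ε_BG_kD^{ε*}_Bg`, no twice-differentiated kernel (compare r14's `norm_covDeriv_G_srcV_le`).
[cite: Balaban1983Higgs3, (1.16) p.414, (2.10) p.426] [cite: Balaban1982Higgs1, (3.16) p.615] -/
theorem norm_covDeriv_G_srcV_le_leibniz {s δA : ℝ} (hA : ∀ b : HiggsLattice.PBond P 0, |A b| ≤ s)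
    (hregA : ∀ (z : HiggsLattice.Site P 0) (μ ν : Fin P.d), |A ⟨z.shift ν, μ⟩ - A ⟨z, μ⟩| ≤ δA)
    (w : ScalarField P 0 N) (b₀ : HiggsLattice.PBond P 0) :
    ‖covDeriv C B (propagatorK C Finset.univ X msq a k (srcV C A B k Finset.univ a w)) b₀‖
      ≤ (∑ b : HiggsLattice.PBond P 0,
          (|C.e| * s * ‖covDeriv C B w b‖ * dcol C msq a k B X b₀ b.tgt
            + ((P.mesh 0)⁻¹ * (|C.e| * δA) * ‖w b.src‖ + |C.e| * s * ‖covDeriv C B w b‖) * dcol C msq a k B X b₀ b.src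
            + (|C.e| * s) ^ 2 * ‖w b.tgt‖ * dcol C msq a k B X b₀ b.tgt))
        + |B1.aSeq a P.L k| * (P.mesh k)⁻¹ ^ 2 *
            ‖covDeriv C B (propagatorK C Finset.univ X msq a k (avgSrc C A B k w)) b₀‖ := by
  have h := norm_mapE_srcV_le_leibniz C A B a k
    (covDerivAt C B b₀ ∘ₗ (propagatorK C Finset.univ X msq a k : ScalarField P 0 N →ₗ[ℝ] ScalarField P 0 N)) hA hregA w
  simp only [LinearMap.coe_comp, Function.comp_apply, B3Op116SourceForm.covDerivAt_apply] at h
  exact h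

/-- **THE VALUE ROW OF `G_k(T,X)V_k(A,B)w` IN LEIBNIZ FORM** (torus): the same with the columns `κ_X(x,·) = col` (exponent 2) — an
alternative to r14's `norm_propagatorK_srcV_apply_le` (there the `D^*M` source is read through the symmetric dipole form against
`κ^D_{B,X}(b,x)`; here against `κ_X(x,b₋)` at the price `ε⁻¹|e|δ_A`). [cite: Balaban1983Higgs3, (1.16) p.414, (2.10) p.426] [cite: Balaban1982Higgs1, (3.16) p.615] -/
theorem norm_G_srcV_apply_le_leibniz {s δA : ℝ} (hA : ∀ b : HiggsLattice.PBond P 0, |A b| ≤ s)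
    (hregA : ∀ (z : HiggsLattice.Site P 0) (μ ν : Fin P.d), |A ⟨z.shift ν, μ⟩ - A ⟨z, μ⟩| ≤ δA)
    (w : ScalarField P 0 N) (x : HiggsLattice.Site P 0) :
    ‖propagatorK C Finset.univ X msq a k (srcV C A B k Finset.univ a w) x‖
      ≤ (∑ b : HiggsLattice.PBond P 0,
          (|C.e| * s * ‖covDeriv C B w b‖ * col C msq a k X x b.tgt
            + ((P.mesh 0)⁻¹ * (|C.e| * δA) * ‖w b.src‖ + |C.e| * s * ‖covDeriv C B w b‖) * col C msq a k X x b.src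
            + (|C.e| * s) ^ 2 * ‖w b.tgt‖ * col C msq a k X x b.tgt))
        + |B1.aSeq a P.L k| * (P.mesh k)⁻¹ ^ 2 *
            ‖propagatorK C Finset.univ X msq a k (avgSrc C A B k w) x‖ := by
  have h := norm_mapE_srcV_le_leibniz C A B a k
    ((LinearMap.proj x : ScalarField P 0 N →ₗ[ℝ] E N) ∘ₗ
      (propagatorK C Finset.univ X msq a k : ScalarField P 0 N →ₗ[ℝ] ScalarField P 0 N)) hA hregA w
  simp only [LinearMap.coe_comp, Function.comp_apply, LinearMap.proj_apply] at h
  exact h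

end GRows

end Literature.MathematicalPhysics.QuantumFieldTheory.Balaban1983to89.B3Op116LeibnizRows
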